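import Summits.QuantumFields.YangMills.Theorems.UnitScaleTiltProp8ChartDefs
import Summits.QuantumFields.YangMills.Theorems.UnitScaleTiltProp7TPrintDefs
import Literature.MathematicalPhysics.QuantumFieldTheory.Balaban1983to89.T3SectALandauChart
import Literature.MathematicalPhysics.QuantumFieldTheory.Balaban1983to89.BlockAveragingZd
import Literature.MathematicalPhysics.QuantumFieldTheory.Balaban1983to89.B8Ineq170
import HarnessLib

/-!
# NEG-hPcol N3 — LETTERS FILE (generic residue-periodic fields; the Pauli field is the sequel `…HPcolNegCommutatorLattice`) (★★OWNER WORD 38 «GO», px12 g11; SPEC-0 e654b2a4 N3a∕N3b; LOCATE v2.1 8aced68d): **THE (0.4) BLOCK AVERAGE OF THE «AXIS-PER-DIRECTION,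
# BLOCK-PERIODIC» PAULI LATTICE IS EXACTLY THE TRIVIAL FIELD AT EVERY LEVEL** — `U_φ := expHermField (b ↦ φ_{b.dir}((b.src b.dir).val % L) • σ_{b.dir})` with `Σ_{r<L} φ_μ(r) = 0`,
# `|φ| ≤ δ ≤ 1∕(40L)`; in particular px12's commutator lattice `φ_μ(r) = s·θ(r)`, `θ = (1, −1, 0, …)` (SPEC N3a `spec_emlAvgU_field_eq_one`, N3b `spec_emlIterU_field_eq_one`).

Cell `ym3-torus`, width seat `ym3-torus-px12` (gen 11).  THEOREMS ONLY (0 `def`, 0 `sorry`); `--supports stmt-QuantumFields-19200 --as helper`, count-neutral.  WHY: the explicit stratum-(c)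
witness behind footnote 17v (the EX display row `hPcol` of S42ᴸ is not inhabitable on backgrounds whose EML average is reducible while they are not; LIFT-THREAD 2 is the repair of record).
THE MECHANISM ([Balaban1987RG1] (0.4) `Ū(c) = exp[mean_i log U(loop_i)]·U(straight)`, tree `Prop8ChartDefs.emlAvgU`): (§1) a level-0 field whose link value depends only on the direction
and on the running coordinate mod `L` pulls back `L`-periodically to `ℤ³` (`pull_add_L`, `hol_pull_add_L`; `L ∣ 2L^{m+K}`); (§2) if moreover every straight block-length run transports to `1`,
the loop variable at index `(r, σ, σ′)` is `A_σ(n)·A_{σ′}(n)⁻¹` (`loopHolU_eq_stair_mul_stair_inv`: `hol_append`, `disp_stairWord`, `hol_revWord'`, periodicity) and swapping `σ ↔ σ′`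
INVERTS it (`loopHolU_swap_eq_inv`); (§3) `eml = 1` + unit line ⇒ `Ū(c) = 1`, and one trivial step ⇒ all iterates trivial; (§4) for the Pauli field: link values (`coe_bgUnits_expHermField`),
the residue property, `U1`-valuedness, and the closed form of straight runs `↑U(x → x + t e_μ) = ↑expHerm((Σ_{j<t} φ_μ((a+j).val % L)) • σ_μ)` (px6 g11 ✓`Prop7HPcolNegPauliExp.expHerm_smul_pauli_mul`);
(§5) `‖V(Γ) − 1‖ ≤ |Γ|·δ` for `U1`-valued links, hence `‖U(loop) − 1‖ ≤ 2·3·((L−1)∕2)·δ ≤ 1∕3`, and routeR-w2 g11 ✓`Prop7HPcolNegEmlPairing.eml_coe_units_eq_one_of_involutive_inv_pairing`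
with the involution `(r, σ, σ′) ↦ (r, σ′, σ)` gives `eml = 1` ⇒ ★★`emlAvgU_pauliField_eq_one`, ★★`emlIterU_pauliField_eq_one`; (§6) the SPEC statements N3a∕N3b token for token.
HONEST SCOPE: lattice bookkeeping about ONE explicit configuration; N3c (`U_s ∈ RegPr ρ` for small `s`), N4, N5, N6 are separate pieces; nothing of the 13 print rows, `hThm2S`, EX or the
crux is proved; not an item refutation, not a display event; YM₃ on T³ = rung R3 — NOT d = 4, NOT infinite volume, NOT a mass gap, NOT Clay; YM gap NOT proved.

References: T. Bałaban, CMP **109** (1987) 249–301 [Balaban1987RG1] ((0.3)–(0.4) pp.252–253, (0.11) p.253); CMP **98** (1985) 17–51 [Balaban1985Averaging] ((8)–(9) p.18, (19) p.21,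
pp.24–25); CMP **102** (1985) 277–309 [Balaban1985Variational] ((112) p.294).
-/

set_option autoImplicit false

noncomputable section

open scoped BigOperators Matrix.Norms.L2Operator Matrix

namespace Summit.QuantumFields.YangMills.Theorems.Prop7HPcolNegCommutatorLatticeLetters

open Literature.MathematicalPhysics.QuantumFieldTheory.Balaban1983to89
open Literature.MathematicalPhysics.QuantumFieldTheory.Balaban1983to89.T3ContinuumYM3Torus
open Literature.MathematicalPhysics.QuantumFieldTheory.Balaban1983to89.T3SectALandauChart (bgUnits)
open Literature.MathematicalPhysics.QuantumLattice (spinHalfPauli)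
open B7Prop1Explicit renaming Site → LSite
open B7Prop1Explicit (Letter e e_apply disp disp_cons disp_replicate disp_revWord hol hol_append hol_revWord' stepHol stepHol_true stepHol_false
  revWord revWord_cons revWord_nil)
open B7Prop1Explicit.Letter (vec_true vec_false)
open B10Eq27TorusAxialLog (holT pull pull_apply hol_pull hol_pull_zero transl transl_apply unitsField toUField val_unitsField val_suIncl)
open T4Continuum (stairWord loopWord wordRev)
open BlockAveraging (Idx off)
open BlockAveragingZd (disp_stairWord length_stairWord l1_offZ_le offZ)
open Summit.QuantumFields.YangMills.Theorems.Prop7TPrint (expHermField expHerm coe_expHerm expHermField_apply)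
open Summit.QuantumFields.YangMills.Theorems.Prop8Chart (emlIterU emlAvgU loopHolU coe_emlAvgU emlIterU_succ emlAvgU_one)
open B7Prop2Explicit (unitaryUnits unitaryUnits_le_U1)
open B7Prop1Explicit (U1 hol_mem stepHol_mem norm_inv_sub_one_le l1)

/-! ## §0 Two word lemmas -/

/-- `wordRev` (NODE 00's letters) IS `revWord` (the engine's letters): both flip every letter and reverse. [folklore] -/
theorem wordRev_eq_revWord {d : ℕ} (w : List (Letter d)) : wordRev w = revWord w := rfl

/-- The reverse of a straight run is the backward run. [folklore] -/
theorem revWord_replicate_true {d : ℕ} (μ : Fin d) : ∀ n : ℕ, revWord (List.replicate n ((μ, true) : Letter d)) = List.replicate n (μ, false)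
  | 0 => by simp
  | n + 1 => by
    rw [List.replicate_succ, revWord_cons, revWord_replicate_true μ n, List.replicate_succ']
    rfl

/-! ## §1 Residue-periodic fields on `T^{(0)}`: `L`-periodicity of the pulled-back transports -/

section Residue

variable {P : Params} {G : Type*}

/-- `((a + t).val) % L = (a.val + t) % L` in `ZMod N` when `L ∣ N` (`t : ℕ`). [folklore] -/
theorem val_add_natCast_mod_eq' {N : ℕ} [NeZero N] {L : ℕ} (hLN : L ∣ N) (a : ZMod N) (t : ℕ) :
    (a + (t : ZMod N)).val % L = (a.val + t) % L := by
  rw [ZMod.val_add, Nat.mod_mod_of_dvd _ hLN, ZMod.val_natCast, Nat.add_mod, Nat.mod_mod_of_dvd _ hLN, ← Nat.add_mod]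

/-- The running coordinate of the translate `transl y (z + L•e_ν)` has the same residue mod `L` as that of `transl y z`. [folklore] -/
theorem transl_add_L_residue (hLN : P.L ∣ P.sitesPerDir 0) (y : Site P 0) (z : LSite P.d) (ν μ : Fin P.d) :
    (transl y (z + (P.L : ℤ) • e ν) μ).val % P.L = (transl y z μ).val % P.L := by
  rw [transl_apply, transl_apply, Pi.add_apply, Pi.smul_apply, Int.cast_add]
  by_cases h : μ = ν
  · subst h
    rw [e_apply, if_pos rfl, smul_eq_mul, mul_one, Int.cast_natCast, ← add_assoc]
    rw [ZMod.val_add, Nat.mod_mod_of_dvd _ hLN, ZMod.val_natCast, Nat.add_mod, Nat.mod_mod_of_dvd _ hLN, Nat.mod_self, add_zero,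
      Nat.mod_mod]
  · rw [e_apply, if_neg h, smul_zero, Int.cast_zero, add_zero]

/-- **`L`-PERIODICITY OF THE PULLED-BACK FIELD** for a field with the residue property. [folklore] -/
theorem pull_add_L (hLN : P.L ∣ P.sitesPerDir 0) (V : GaugeField P 0 G)
    (hV : ∀ b b' : PBond P 0, b.dir = b'.dir → (b.src b.dir).val % P.L = (b'.src b'.dir).val % P.L → V b = V b')
    (y : Site P 0) (z : LSite P.d) (ν μ : Fin P.d) :
    pull V y (z + (P.L : ℤ) • e ν) μ = pull V y z μ := by
  rw [pull_apply, pull_apply]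
  exact hV _ _ rfl (transl_add_L_residue hLN y z ν μ)

/-- The one-letter transport is `L`-periodic. [folklore] -/
theorem stepHol_pull_add_L [Group G] (hLN : P.L ∣ P.sitesPerDir 0) (V : GaugeField P 0 G)
    (hV : ∀ b b' : PBond P 0, b.dir = b'.dir → (b.src b.dir).val % P.L = (b'.src b'.dir).val % P.L → V b = V b')
    (y : Site P 0) (x : LSite P.d) (ν : Fin P.d) (l : Letter P.d) :
    stepHol (pull V y) (x + (P.L : ℤ) • e ν) l = stepHol (pull V y) x l := by
  obtain ⟨μ, b⟩ := l
  cases b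
  · rw [stepHol_false, stepHol_false, show x + (P.L : ℤ) • e ν - e μ = (x - e μ) + (P.L : ℤ) • e ν by abel,
      pull_add_L hLN V hV]
  · rw [stepHol_true, stepHol_true, pull_add_L hLN V hV]

/-- **`L`-PERIODICITY OF TRANSPORTS**: translating the start of a word by `L•e_ν` does not change the pulled-back transport. [folklore] -/
theorem hol_pull_add_L [Group G] (hLN : P.L ∣ P.sitesPerDir 0) (V : GaugeField P 0 G)
    (hV : ∀ b b' : PBond P 0, b.dir = b'.dir → (b.src b.dir).val % P.L = (b'.src b'.dir).val % P.L → V b = V b')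
    (y : Site P 0) (ν : Fin P.d) : ∀ (x : LSite P.d) (w : List (Letter P.d)),
    hol (pull V y) (x + (P.L : ℤ) • e ν) w = hol (pull V y) x w
  | x, [] => by simp [hol]
  | x, l :: w => by
    rw [show hol (pull V y) (x + (P.L : ℤ) • e ν) (l :: w) = stepHol (pull V y) (x + (P.L : ℤ) • e ν) l * hol (pull V y) (x + (P.L : ℤ) • e ν + l.vec) w from rfl,
      show hol (pull V y) x (l :: w) = stepHol (pull V y) x l * hol (pull V y) (x + l.vec) w from rfl,
      stepHol_pull_add_L hLN V hV, show x + (P.L : ℤ) • e ν + l.vec = (x + l.vec) + (P.L : ℤ) • e ν by abel, hol_pull_add_L hLN V hV y ν (x + l.vec) w]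

end Residue

/-! ## §2 The (0.4) loop variable of an `L`-periodic field with UNIT LINE PRODUCTS is `A_σ · A_{σ′}⁻¹` -/

section Loop

variable {P : Params} {𝔸 : Type*} [NormedRing 𝔸]

/-- **LOOP DECOMPOSITION**: if every straight block-length run of `V` transports to `1`, then the loop variable `U(Γ_σ ∪ [x,x′] ∪ (−Γ′_{σ′}) ∪ (−c))` at the coarse bond
`c`, index `(r, σ, σ′)`, is `A_σ(n) · A_{σ′}(n)⁻¹`, `A_σ(n) = U(Γ_σ)` the staircase transport from the block centre, `n = off r`. [cite: Balaban1987RG1, (0.4) p.253] -/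
theorem loopHolU_eq_stair_mul_stair_inv (hLN : P.L ∣ P.sitesPerDir 0) (V : GaugeField P 0 𝔸ˣ)
    (hV : ∀ b b' : PBond P 0, b.dir = b'.dir → (b.src b.dir).val % P.L = (b'.src b'.dir).val % P.L → V b = V b')
    (hline : ∀ (y : Site P 0) (z : LSite P.d) (μ : Fin P.d), hol (pull V y) z (List.replicate P.L (μ, true)) = 1)
    (c : PBond P 1) (i : Idx P) :
    loopHolU V c i = hol (pull V (emb c.src)) 0 (stairWord i.2.1 (off i.1)) * (hol (pull V (emb c.src)) 0 (stairWord i.2.2 (off i.1)))⁻¹ := by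
  set W := pull V (emb c.src) with hW
  set n := off i.1 with hn
  set μ := c.dir with hμ
  have h0 : loopHolU V c i = hol W 0 (loopWord P.L μ n i.2.1 i.2.2) := by
    rw [loopHolU, ← hol_pull_zero]
  have hL : hol W ((((P.L : ℕ) : ℤ)) • e μ) (stairWord i.2.2 n) = hol W 0 (stairWord i.2.2 n) := by
    rw [show ((((P.L : ℕ) : ℤ)) • e μ : LSite P.d) = 0 + ((P.L : ℕ) : ℤ) • e μ by rw [zero_add]]
    exact hol_pull_add_L hLN V hV (emb c.src) μ 0 _
  have hrev : hol W (n + ((P.L : ℕ) : ℤ) • e μ) (revWord (stairWord i.2.2 n)) = (hol W 0 (stairWord i.2.2 n))⁻¹ := by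
    rw [hol_revWord' W (x := ((P.L : ℕ) : ℤ) • e μ) (n + ((P.L : ℕ) : ℤ) • e μ) (stairWord i.2.2 n) (by rw [disp_stairWord, add_comm]), hL]
  have hback : hol W (n + ((P.L : ℕ) : ℤ) • e μ + -n) (List.replicate P.L (μ, false)) = 1 := by
    rw [show n + ((P.L : ℕ) : ℤ) • e μ + -n = (0 : LSite P.d) + ((P.L : ℕ) : ℤ) • e μ by abel, ← revWord_replicate_true,
      hol_revWord' W (x := (0 : LSite P.d)) ((0 : LSite P.d) + ((P.L : ℕ) : ℤ) • e μ) (List.replicate P.L (μ, true))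
        (by rw [disp_replicate, vec_true]), hline, inv_one]
  rw [h0, loopWord, hol_append, disp_stairWord, zero_add, hol_append, disp_replicate, vec_true, hline, one_mul, hol_append,
    wordRev_eq_revWord, disp_revWord, disp_stairWord, hrev, hback, mul_one]

/-- **THE PAIRING**: swapping the two staircase orderings inverts the loop variable. [cite: Balaban1987RG1, (0.4) p.253] -/
theorem loopHolU_swap_eq_inv (hLN : P.L ∣ P.sitesPerDir 0) (V : GaugeField P 0 𝔸ˣ)
    (hV : ∀ b b' : PBond P 0, b.dir = b'.dir → (b.src b.dir).val % P.L = (b'.src b'.dir).val % P.L → V b = V b')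
    (hline : ∀ (y : Site P 0) (z : LSite P.d) (μ : Fin P.d), hol (pull V y) z (List.replicate P.L (μ, true)) = 1)
    (c : PBond P 1) (i : Idx P) :
    loopHolU V c (i.1, i.2.2, i.2.1) = (loopHolU V c i)⁻¹ := by
  rw [loopHolU_eq_stair_mul_stair_inv hLN V hV hline, loopHolU_eq_stair_mul_stair_inv hLN V hV hline, mul_inv_rev, inv_inv]

end Loop

/-! ## §3 From `eml(loops) = 1` and unit line products to `Ū ≡ 1`, and then every iterate `≡ 1` -/

section Avg

variable {P : Params} {𝔸 : Type*} [NormedRing 𝔸] [NormedAlgebra ℂ 𝔸] [CompleteSpace 𝔸]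

/-- If the `exp[mean log]` of the loop variables at `c` is `1` and the straight block-length run from the centre transports to `1`, then `Ū(c) = 1`.
[cite: Balaban1987RG1, (0.4) p.253] -/
theorem emlAvgU_apply_eq_one {j : ℕ} (V : GaugeField P j 𝔸ˣ) (c : PBond P (j + 1))
    (heml : ExpMeanLog.eml (fun i : Idx P => ((loopHolU V c i : 𝔸ˣ) : 𝔸)) = 1)
    (hline : holT V (emb c.src) (List.replicate P.L (c.dir, true)) = 1) : emlAvgU V c = 1 := by
  apply Units.ext
  rw [coe_emlAvgU, heml, hline, Units.val_one, mul_one]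

/-- If ONE (0.4) step averages `U` to the trivial field, so does every iterate `k ≥ 1`. [cite: Balaban1987RG1, (0.11) p.253] -/
theorem emlIterU_eq_one_of_emlAvgU_eq_one (U : GaugeField P 0 𝔸ˣ) (hU : emlAvgU U = fun _ => 1) :
    ∀ k : ℕ, 1 ≤ k → emlIterU k U = fun _ => 1
  | 0, h => absurd h (by norm_num)
  | 1, _ => by rw [emlIterU_succ, Prop8Chart.emlIterU_zero, hU]
  | k + 2, _ => by rw [emlIterU_succ, emlIterU_eq_one_of_emlAvgU_eq_one U hU (k + 1) (by omega), emlAvgU_one]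

end Avg

/-! ## §5 Smallness of the loop variables; `Ū_φ ≡ 1`; every iterate `≡ 1` -/

section Small

variable {d : ℕ} {𝔸 : Type*} [NormedRing 𝔸] [NormOneClass 𝔸]

/-- **`‖V(Γ) − 1‖ ≤ |Γ|·δ`** for `U1`-valued links each within `δ` of `1`. [cite: Balaban1985Averaging, pp.24–25] -/
theorem norm_coe_hol_sub_one_le_length_mul {V : LSite d → Fin d → 𝔸ˣ} (hV : ∀ x κ, V x κ ∈ U1 𝔸) {δ : ℝ}
    (hδ : ∀ x κ, ‖(V x κ : 𝔸) - 1‖ ≤ δ) : ∀ (x : LSite d) (w : List (Letter d)), ‖((hol V x w : 𝔸ˣ) : 𝔸) - 1‖ ≤ w.length * δ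
  | x, [] => by simp [hol]
  | x, l :: w => by
    have hstep : ‖((stepHol V x l : 𝔸ˣ) : 𝔸) - 1‖ ≤ δ := by
      obtain ⟨μ, b⟩ := l
      cases b
      · rw [stepHol_false]; exact (norm_inv_sub_one_le (hV _ _)).trans (hδ _ _)
      · rw [stepHol_true]; exact hδ _ _
    rw [show hol V x (l :: w) = stepHol V x l * hol V (x + l.vec) w from rfl, Units.val_mul, List.length_cons, Nat.cast_succ, add_mul, one_mul]
    have ih := norm_coe_hol_sub_one_le_length_mul hV hδ (x + l.vec) w
    have := B8Ineq170.norm_mul_sub_one_le_of_norm_le_one (b := ((hol V (x + l.vec) w : 𝔸ˣ) : 𝔸)) (stepHol_mem hV x l).1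
    linarith

end Small


end Summit.QuantumFields.YangMills.Theorems.Prop7HPcolNegCommutatorLatticeLetters

end
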